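import Mathlib
import Summits.ValiantsHypothesis.ValiantsHypothesis.Theorems.NewtonUnitEquationsNewtonTauWeakWeightedLevelSetHull
import Summits.ValiantsHypothesis.ValiantsHypothesis.Theorems.NewtonUnitEquationsNewtonTauWeakWeightedNormalForm
import Summits.ValiantsHypothesis.ValiantsHypothesis.Theorems.NewtonUnitEquationsNewtonTauWeakRefineDissociate

/-!
# `NewtonUnitEquationsNewtonTauWeakKernelBootstrap` — kernel bootstrap for hull counts of weighted level sets

Registered stub `kernelBootstrap` (STUB-PLAN Tier 1, rung S4) of crux `NewtonTauWeak` (stmt-ValiantsHypothesis-5904),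
line `binomial-normal-form`: **`V(N, c) ≤ (4N² + 5) · V(4c², c)`**, here granted the PINNED exchange normal form
(`kernelBootstrapOfNF`).  Items `j : Fin N`, weights `1 ≤ g j ≤ c`, exponents `d j ∈ ℕ²` (coincidences allowed),
`X_v = {Σ_{j ∈ J} d j : Σ_{j ∈ J} g j = v}`.  If every weighted level set on at most `4c²` items with weights in
`[1, c]` has at most `B` hull vertices, then `conv X_v` has at most `(4N² + 5) · B` extreme points.

Proof.  An extreme point `e` is strictly exposed by a direction `w` (`stub_exposedGenericDirection`); with the
values `c' j = ⟨w, d j⟩` it is the point of a maximiser `J₀` of `Σ_J c'` over `{Σ_J g = v}`, hence (`hNF`) of the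
canonical set `K = canon c' k₀ α β` at the PINNED prefix length `k₀` (`Σ_a (α a + β a) ≤ 2c`).  The density rank,
`k₀`, the prefix `P = {rk < k₀}` and the KERNEL `L` (prefix items with `< 2c` same-weight prefix items below them,
non-prefix items with `< 2c` same-weight non-prefix items above them; `|L| ≤ 4c·c` since ranks are injective
inside a class, `KernelBootstrapAux.card_classRank_lt_le`) depend on `w` only through the sign vector `σ` of the
`N · N` functionals `⟨w, g j • d j' - g j' • d j⟩` (`WeightedLevelSetHullAux.canon_eq_of_signs`; at most `4N² + 5`
of them, `ResidueDesignHullAux.signvec_plane_count`).  As `α (g j), β (g j) ≤ 2c`, `K \ L = P \ L`, so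
`e = pt (P \ L) + pt S` with `S = K ∩ L`, and `pt S` is the STRICT maximiser of `⟨w, ·⟩` over the kernel level set
`{pt S' : S' ⊆ L, wt S' = v - wt (P \ L)}` (a competitor `S'` gives the competitor `(P \ L) ∪ S'` of `J₀`), hence
an extreme point of its hull (`RefineDissociateAux.emb_mem_extremePoints_of_strict`); reindexed by `Fin |L|`
(`L.orderEmbOfFin`) the kernel level set is an instance of `hB`.  So the extreme points lie in the union over the
realised `σ` of translates of kernel vertex sets: at most `(4N² + 5) · B` of them.  Folklore throughout (planar
convexity, exchange argument, counting); no named facts, no citations, no `def`s.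
-/

-- Sub = Summit single-conjunct layout: the duplicated namespace component is mandated by the tree.
set_option linter.dupNamespace false

noncomputable section

open scoped BigOperators

namespace Summit.ValiantsHypothesis.ValiantsHypothesis.Theorems.NewtonUnitEquationsNewtonTauWeak

namespace KernelBootstrapAux

variable {N : ℕ}

/-- A union over a finset of sets of size `≤ B` has size `≤ |T| · B`. [folklore] -/
theorem ncard_biUnion_le {ι α : Type*} [DecidableEq ι] (T : Finset ι) (A : ι → Set α) (B : ℕ)
    (hA : ∀ i ∈ T, (A i).ncard ≤ B) : (⋃ i ∈ T, A i).ncard ≤ T.card * B := by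
  induction T using Finset.induction_on with
  | empty => simp
  | insert i T hi ih =>
    rw [Finset.set_biUnion_insert, Finset.card_insert_of_notMem hi]
    calc (A i ∪ ⋃ x ∈ T, A x).ncard ≤ (A i).ncard + (⋃ x ∈ T, A x).ncard := Set.ncard_union_le _ _
      _ ≤ B + T.card * B := Nat.add_le_add (hA i (Finset.mem_insert_self i T))
          (ih fun x hx => hA x (Finset.mem_insert_of_mem hx))
      _ = (T.card + 1) * B := by ring

section rank

variable (r : Fin N → Fin N → Prop) [DecidableRel r]
  (hord : ∀ x y z, ¬ r x x ∧ (r x y → r y z → r x z) ∧ (x ≠ y → r x y ∨ r y x))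
include hord

/-- For a strict total order `r` on `S`, at most `m` elements of `S` have rank `#{z ∈ S | r z x} < m` (the rank
is injective on `S`, `WeightedNormalFormAux.rank_injOn`). [folklore] -/
theorem card_filter_rank_lt_le (S : Finset (Fin N)) (m : ℕ) :
    (S.filter fun x => (S.filter (r · x)).card < m).card ≤ m := by
  calc (S.filter fun x => (S.filter (r · x)).card < m).card ≤ (Finset.range m).card :=
        Finset.card_le_card_of_injOn (fun x => (S.filter (r · x)).card)
          (fun x hx => Finset.mem_coe.2 (Finset.mem_range.2 (Finset.mem_filter.1 hx).2))
          ((WeightedNormalFormAux.rank_injOn r hord S).mono (Finset.coe_subset.2 (Finset.filter_subset _ S)))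
    _ = m := Finset.card_range m

/-- **Kernels are small.**  For weights `g j ∈ [1, c]`, a predicate `p` and a strict total order `r`, at most
`c · m` items `j` satisfy `p` and have fewer than `m` items `j'` with `p j'`, the same weight and `r j' j`: class
by class these are the items of `r`-rank `< m` inside `{p} ∩ g⁻¹ a`, `a ∈ (0, c]`. [folklore] -/
theorem card_classRank_lt_le (c m : ℕ) (g : Fin N → ℕ) (hg : ∀ j, 1 ≤ g j ∧ g j ≤ c)
    (p : Fin N → Prop) [DecidablePred p] :
    (Finset.univ.filter fun j : Fin N =>
        p j ∧ (Finset.univ.filter fun j' : Fin N => p j' ∧ g j' = g j ∧ r j' j).card < m).card ≤ c * m := by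
  rw [Finset.card_eq_sum_card_fiberwise (f := g) (t := Finset.Ioc 0 c)
    (fun j _ => Finset.mem_coe.2 (Finset.mem_Ioc.2 ⟨(hg j).1, (hg j).2⟩))]
  calc _ ≤ ∑ _a ∈ Finset.Ioc 0 c, m := Finset.sum_le_sum fun a _ => ?_
    _ = c * m := by rw [Finset.sum_const, Nat.card_Ioc, smul_eq_mul, Nat.sub_zero]
  -- the fibre over `a` consists of the items of rank `< m` in `S = {p} ∩ g⁻¹ a`
  calc _ ≤ ((Finset.univ.filter fun j' : Fin N => p j' ∧ g j' = a).filter fun x =>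
          ((Finset.univ.filter fun j' : Fin N => p j' ∧ g j' = a).filter (r · x)).card < m).card :=
        Finset.card_le_card fun j hj => ?_
    _ ≤ m := card_filter_rank_lt_le r hord _ m
  simp only [Finset.mem_filter, Finset.mem_univ, true_and] at hj
  obtain ⟨⟨hpj, hlt⟩, hja⟩ := hj
  refine Finset.mem_filter.2 ⟨Finset.mem_filter.2 ⟨Finset.mem_univ _, hpj, hja⟩, ?_⟩
  rw [Finset.filter_filter]
  convert hlt using 2
  refine Finset.filter_congr fun j' _ => ?_
  rw [hja, and_assoc]

end rank

/-- **The density order is a strict total order**, for any relation `D` pointwise equivalent to it (the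
lexicographic order of the key `(-c' x / g x, x)`, `WeightedNormalFormAux.above_iff`). [folklore] -/
theorem density_order (g : Fin N → ℕ) (hg : ∀ j, (0 : ℝ) < g j) (c' : Fin N → ℝ)
    (D : Fin N → Fin N → Prop)
    (hD : ∀ x y, D x y ↔
      (c' y * (g x : ℝ) < c' x * (g y : ℝ) ∨ (c' x * (g y : ℝ) = c' y * (g x : ℝ) ∧ x < y))) :
    ∀ x y z, ¬ D x x ∧ (D x y → D y z → D x z) ∧ (x ≠ y → D x y ∨ D y x) := by
  have key := WeightedNormalFormAux.above_iff g c' hg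
  intro x y z
  refine ⟨fun h => ResidueNormalFormAux.key_irrefl (fun j => -c' j / g j) x ((key x x).1 ((hD x x).1 h)),
    fun h₁ h₂ => (hD x z).2 ((key x z).2 (ResidueNormalFormAux.key_trans (fun j => -c' j / g j)
      ((key x y).1 ((hD x y).1 h₁)) ((key y z).1 ((hD y z).1 h₂)))),
    fun hne => (ResidueNormalFormAux.key_total (fun j => -c' j / g j) hne).imp
      (fun h => (hD x y).2 ((key x y).2 h)) (fun h => (hD y x).2 ((key y x).2 h))⟩

/-- The reverse of a strict total order, read through a pointwise equivalence, is a strict total order.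
[folklore] -/
theorem order_of_iff_flip (D r : Fin N → Fin N → Prop)
    (hord : ∀ x y z, ¬ D x x ∧ (D x y → D y z → D x z) ∧ (x ≠ y → D x y ∨ D y x))
    (hr : ∀ x y, r x y ↔ D y x) : ∀ x y z, ¬ r x x ∧ (r x y → r y z → r x z) ∧ (x ≠ y → r x y ∨ r y x) :=
  fun x y z => ⟨fun h => (hord x x x).1 ((hr x x).1 h),
    fun h₁ h₂ => (hr x z).2 ((hord z y x).2.1 ((hr y z).1 h₂) ((hr x y).1 h₁)),
    fun hne => ((hord y x y).2.2 hne.symm).imp (hr x y).2 (hr y x).2⟩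

/-- **Reindexing a sub-family.**  The subset sums of `S' ⊆ L` of weight `v'` are exactly the subset sums of the
family reindexed by `Fin |L|` along `L.orderEmbOfFin`. [folklore] -/
theorem image_powerset_eq_image_reindex (L : Finset (Fin N)) (g : Fin N → ℕ) (d : Fin N → (Fin 2 →₀ ℕ))
    (v' : ℕ) :
    ((Finset.univ.filter fun J : Finset (Fin L.card) => ∑ i ∈ J, g (L.orderEmbOfFin rfl i) = v').image
        fun J => ∑ i ∈ J, d (L.orderEmbOfFin rfl i)) =
      (L.powerset.filter fun S' => ∑ j ∈ S', g j = v').image fun S' => ∑ j ∈ S', d j := by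
  classical
  set f := L.orderEmbOfFin rfl with hf
  ext p
  simp only [Finset.mem_image, Finset.mem_filter, Finset.mem_univ, true_and, Finset.mem_powerset]
  constructor
  · rintro ⟨J, hJ, rfl⟩
    refine ⟨J.map f.toEmbedding, ⟨fun x hx => ?_, ?_⟩, ?_⟩
    · obtain ⟨i, -, rfl⟩ := Finset.mem_map.1 hx
      exact L.orderEmbOfFin_mem rfl i
    · rw [Finset.sum_map, ← hJ]
      rfl
    · rw [Finset.sum_map]
      rfl
  · rintro ⟨S', ⟨hS'L, hS'v⟩, rfl⟩
    have hmap : (Finset.univ.filter fun i => f i ∈ S').map f.toEmbedding = S' := by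
      ext x
      simp only [Finset.mem_map, Finset.mem_filter, Finset.mem_univ, true_and, RelEmbedding.coe_toEmbedding]
      constructor
      · rintro ⟨i, hi, rfl⟩
        exact hi
      · intro hx
        have hxr : x ∈ Set.range f := by
          rw [hf, Finset.range_orderEmbOfFin]
          exact hS'L hx
        obtain ⟨i, rfl⟩ := hxr
        exact ⟨i, hx, rfl⟩
    have hg' := Finset.sum_map (Finset.univ.filter fun i => f i ∈ S') f.toEmbedding g
    have hd' := Finset.sum_map (Finset.univ.filter fun i => f i ∈ S') f.toEmbedding d
    rw [hmap] at hg' hd'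
    refine ⟨Finset.univ.filter fun i => f i ∈ S', ?_, ?_⟩
    · rw [← hS'v, hg']
      rfl
    · rw [hd']
      rfl

end KernelBootstrapAux

/-- **Kernel bootstrap from the pinned normal form** (`V(N, c) ≤ (4N² + 5) · V(4c², c)`).  For weights
`1 ≤ g j ≤ c` and exponents `d j ∈ ℕ²` (`j : Fin N`, coincidences allowed), granted the PINNED exchange normal
form `hNF` of the maximisers of linear functions over `{J : Σ_J g j = v}` (canonical sets `canon c' k₀ α β` at the
pinned prefix length `k₀ = Nat.findGreatest (prefix weight ≤ v) N`, `Σ_{a ≤ c} (α a + β a) ≤ 2c`; `hrk`, `hcanon`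
characterise the density rank and the canonical sets): if every weighted level set on `n ≤ 4c·c` items with weights
in `[1, c]` has at most `B` hull vertices (`hB`), then the convex hull of `X_v = {Σ_{j ∈ J} d j : Σ_{j ∈ J} g j = v}`
has at most `(4 (N * N) + 5) · B` extreme points.  Proof in the module docstring. [folklore] -/
theorem kernelBootstrapOfNF (N c v B : ℕ) (g : Fin N → ℕ) (hg : ∀ j, 1 ≤ g j ∧ g j ≤ c)
    (d : Fin N → (Fin 2 →₀ ℕ))
    (rk : (Fin N → ℝ) → Fin N → ℕ)
    (hrk : ∀ c' j, rk c' j = (Finset.univ.filter fun j' : Fin N =>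
        c' j * (g j' : ℝ) < c' j' * (g j : ℝ) ∨ (c' j' * (g j : ℝ) = c' j * (g j' : ℝ) ∧ j' < j)).card)
    (canon : (Fin N → ℝ) → ℕ → (ℕ → ℕ) → (ℕ → ℕ) → Finset (Fin N))
    (hcanon : ∀ c' k α β, canon c' k α β = Finset.univ.filter fun j : Fin N =>
        (rk c' j < k ∧ α (g j) ≤ (Finset.univ.filter fun j' : Fin N =>
            rk c' j' < k ∧ g j' = g j ∧
              (c' j' * (g j : ℝ) < c' j * (g j' : ℝ) ∨ (c' j * (g j' : ℝ) = c' j' * (g j : ℝ) ∧ j < j'))).card) ∨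
        (k ≤ rk c' j ∧ (Finset.univ.filter fun j' : Fin N =>
            k ≤ rk c' j' ∧ g j' = g j ∧
              (c' j * (g j' : ℝ) < c' j' * (g j : ℝ) ∨ (c' j' * (g j : ℝ) = c' j * (g j' : ℝ) ∧ j' < j))).card
            < β (g j)))
    (hNF : ∀ (c' : Fin N → ℝ) (J : Finset (Fin N)), ∑ j ∈ J, g j = v →
        (∀ J' : Finset (Fin N), ∑ j ∈ J', g j = v → ∑ j ∈ J', c' j ≤ ∑ j ∈ J, c' j) →
        ∃ α β : ℕ → ℕ, (∑ a ∈ Finset.range (c + 1), (α a + β a) ≤ 2 * c) ∧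
          ∑ j ∈ canon c'
              (Nat.findGreatest (fun k => ∑ j ∈ (Finset.univ.filter fun j : Fin N => rk c' j < k), g j ≤ v) N)
              α β, g j = v ∧
          ∑ j ∈ canon c'
              (Nat.findGreatest (fun k => ∑ j ∈ (Finset.univ.filter fun j : Fin N => rk c' j < k), g j ≤ v) N)
              α β, c' j = ∑ j ∈ J, c' j)
    (hB : ∀ (n v' : ℕ) (g' : Fin n → ℕ) (d' : Fin n → (Fin 2 →₀ ℕ)), n ≤ 4 * c * c →
      (∀ j, 1 ≤ g' j ∧ g' j ≤ c) →
      (Set.extremePoints ℝ (convexHull ℝ ((fun e : Fin 2 →₀ ℕ => fun i : Fin 2 => ((e i : ℕ) : ℝ)) ''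
        (((Finset.univ.filter fun J : Finset (Fin n) => ∑ j ∈ J, g' j = v').image
          fun J => ∑ j ∈ J, d' j : Finset (Fin 2 →₀ ℕ)) : Set (Fin 2 →₀ ℕ))))).ncard ≤ B) :
    (Set.extremePoints ℝ (convexHull ℝ ((fun e : Fin 2 →₀ ℕ => fun i : Fin 2 => ((e i : ℕ) : ℝ)) ''
      (((Finset.univ.filter fun J : Finset (Fin N) => ∑ j ∈ J, g j = v).image
        fun J => ∑ j ∈ J, d j : Finset (Fin 2 →₀ ℕ)) : Set (Fin 2 →₀ ℕ))))).ncard ≤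
      (4 * (N * N) + 5) * B := by
  classical
  have hgpos : ∀ j, (0 : ℝ) < g j := fun j => Nat.cast_pos.2 (hg j).1
  -- the `N * N` linear functionals `w ↦ ⟨w, g j • d j' - g j' • d j⟩`, pairs `(j', j)` via `finProdFinEquiv`
  obtain ⟨u, hup⟩ : ∃ u : Fin (N * N) → Fin 2 → ℝ, ∀ j' j i, u (finProdFinEquiv (j', j)) i =
      (g j : ℝ) * ((d j' i : ℕ) : ℝ) - (g j' : ℝ) * ((d j i : ℕ) : ℝ) := by
    refine ⟨fun p i => (g (finProdFinEquiv.symm p).2 : ℝ) * ((d (finProdFinEquiv.symm p).1 i : ℕ) : ℝ) -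
        (g (finProdFinEquiv.symm p).1 : ℝ) * ((d (finProdFinEquiv.symm p).2 i : ℕ) : ℝ), fun j' j i => by
      simp only [Equiv.symm_apply_apply]⟩
  -- values of a direction; heights of subset sums are sums of values; the sign vector records density comparisons
  have hlin : ∀ (w : Fin 2 → ℝ) (c' : Fin N → ℝ), (∀ j, c' j = ∑ i, w i * ((d j i : ℕ) : ℝ)) →
      ∀ J : Finset (Fin N), ∑ i, w i * (((∑ j ∈ J, d j) i : ℕ) : ℝ) = ∑ j ∈ J, c' j := by
    intro w c' hc J
    simp only [Finsupp.finsetSum_apply, Nat.cast_sum, Finset.mul_sum, hc]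
    exact Finset.sum_comm
  have hsign : ∀ (w : Fin 2 → ℝ) (c' : Fin N → ℝ), (∀ j, c' j = ∑ i, w i * ((d j i : ℕ) : ℝ)) →
      ∀ j' j, SignType.sign (∑ i, w i * u (finProdFinEquiv (j', j)) i) =
        SignType.sign (c' j' * (g j : ℝ) - c' j * (g j' : ℝ)) := by
    intro w c' hc j' j
    congr 1
    rw [hc, hc, Finset.sum_mul, Finset.sum_mul, ← Finset.sum_sub_distrib]
    exact Finset.sum_congr rfl fun i _ => by rw [hup]; ring
  -- the rank, the pinned prefix length, the prefix, the kernel and the canonical set read off from a sign vector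
  obtain ⟨R, hR⟩ : ∃ R : (Fin (N * N) → SignType) → Fin N → ℕ, ∀ σ j, R σ j =
      (Finset.univ.filter fun j' : Fin N =>
        σ (finProdFinEquiv (j', j)) = 1 ∨ (σ (finProdFinEquiv (j', j)) = 0 ∧ j' < j)).card :=
    ⟨_, fun _ _ => rfl⟩
  obtain ⟨K0, hK0⟩ : ∃ K0 : (Fin N → ℕ) → ℕ, ∀ r, K0 r =
      Nat.findGreatest (fun k => ∑ j ∈ (Finset.univ.filter fun j : Fin N => r j < k), g j ≤ v) N :=
    ⟨_, fun _ => rfl⟩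
  obtain ⟨P, hP⟩ : ∃ P : (Fin (N * N) → SignType) → Finset (Fin N), ∀ σ,
      P σ = Finset.univ.filter fun j : Fin N => R σ j < K0 (R σ) := ⟨_, fun _ => rfl⟩
  obtain ⟨L, hL⟩ : ∃ L : (Fin (N * N) → SignType) → Finset (Fin N), ∀ σ,
      L σ = Finset.univ.filter fun j : Fin N =>
        (R σ j < K0 (R σ) ∧ (Finset.univ.filter fun j' : Fin N =>
            R σ j' < K0 (R σ) ∧ g j' = g j ∧
              (σ (finProdFinEquiv (j', j)) = -1 ∨ (σ (finProdFinEquiv (j, j')) = 0 ∧ j < j'))).card < 2 * c) ∨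
        (K0 (R σ) ≤ R σ j ∧ (Finset.univ.filter fun j' : Fin N =>
            K0 (R σ) ≤ R σ j' ∧ g j' = g j ∧
              (σ (finProdFinEquiv (j', j)) = 1 ∨ (σ (finProdFinEquiv (j', j)) = 0 ∧ j' < j))).card < 2 * c) :=
    ⟨_, fun _ => rfl⟩
  obtain ⟨F, hF⟩ :
      ∃ F : (Fin (N * N) → SignType) → ℕ → (ℕ → ℕ) → (ℕ → ℕ) → Finset (Fin N), ∀ σ k α β,
      F σ k α β = Finset.univ.filter fun j : Fin N =>
        (R σ j < k ∧ α (g j) ≤ (Finset.univ.filter fun j' : Fin N =>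
            R σ j' < k ∧ g j' = g j ∧
              (σ (finProdFinEquiv (j', j)) = -1 ∨ (σ (finProdFinEquiv (j, j')) = 0 ∧ j < j'))).card) ∨
        (k ≤ R σ j ∧ (Finset.univ.filter fun j' : Fin N =>
            k ≤ R σ j' ∧ g j' = g j ∧
              (σ (finProdFinEquiv (j', j)) = 1 ∨ (σ (finProdFinEquiv (j', j)) = 0 ∧ j' < j))).card
            < β (g j)) :=
    ⟨_, fun _ _ _ _ => rfl⟩
  -- the kernel vertex set of a sign vector (kernel reindexed by `Fin |L σ|`) and its translate by `pt (P σ \ L σ)`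
  obtain ⟨E, hE⟩ : ∃ E : (Fin (N * N) → SignType) → Set (Fin 2 → ℝ), ∀ σ, E σ =
      Set.extremePoints ℝ (convexHull ℝ ((fun e : Fin 2 →₀ ℕ => fun i : Fin 2 => ((e i : ℕ) : ℝ)) ''
        (((Finset.univ.filter fun J : Finset (Fin (L σ).card) =>
            ∑ i ∈ J, g ((L σ).orderEmbOfFin rfl i) = v - ∑ j ∈ P σ \ L σ, g j).image
          fun J => ∑ i ∈ J, d ((L σ).orderEmbOfFin rfl i) : Finset (Fin 2 →₀ ℕ)) : Set (Fin 2 →₀ ℕ)))) :=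
    ⟨_, fun _ => rfl⟩
  obtain ⟨T, hT⟩ : ∃ T : (Fin (N * N) → SignType) → Set (Fin 2 → ℝ), ∀ σ, T σ =
      (fun p : Fin 2 → ℝ => (fun i : Fin 2 => (((∑ j ∈ P σ \ L σ, d j) i : ℕ) : ℝ)) + p) '' E σ :=
    ⟨_, fun _ => rfl⟩
  have hEfin : ∀ σ, (E σ).Finite := fun σ => by
    rw [hE]
    exact ((Finset.finite_toSet _).image _).subset extremePoints_convexHull_subset
  -- the realised sign vectors
  obtain ⟨V, hV⟩ : ∃ V : Set (Fin (N * N) → SignType),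
      V = {v | ∃ w : Fin 2 → ℝ, v = fun m => SignType.sign (∑ i, w i * u m i)} := ⟨_, rfl⟩
  have hVfin : V.Finite := Set.toFinite V
  have hVcard : hVfin.toFinset.card ≤ 4 * (N * N) + 5 := by
    rw [← Set.ncard_eq_toFinset_card V hVfin, hV]
    exact ResidueDesignHullAux.signvec_plane_count _ u
  -- (A) every realised sign vector has a small kernel, so its translated kernel vertex set has at most `B` points
  have hTB : ∀ σ ∈ hVfin.toFinset, (T σ).ncard ≤ B := by
    intro σ hσ
    rw [Set.Finite.mem_toFinset, hV] at hσ
    obtain ⟨w, hσw⟩ := hσ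
    obtain ⟨c', hc⟩ : ∃ c' : Fin N → ℝ, ∀ j, c' j = ∑ i, w i * ((d j i : ℕ) : ℝ) := ⟨_, fun _ => rfl⟩
    have hvp : ∀ j' j, σ (finProdFinEquiv (j', j)) = SignType.sign (c' j' * (g j : ℝ) - c' j * (g j' : ℝ)) :=
      fun j' j => by rw [hσw]; exact hsign w c' hc j' j
    have hordA := KernelBootstrapAux.density_order g hgpos c'
      (fun x y => σ (finProdFinEquiv (x, y)) = 1 ∨ (σ (finProdFinEquiv (x, y)) = 0 ∧ x < y))
      (fun x y => by simp only [hvp, sign_eq_one_iff, sign_eq_zero_iff, sub_pos, sub_eq_zero])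
    have hordD := KernelBootstrapAux.density_order g hgpos c' _ (fun x y => Iff.rfl)
    have hbelow : ∀ x y, (σ (finProdFinEquiv (x, y)) = -1 ∨ (σ (finProdFinEquiv (y, x)) = 0 ∧ y < x)) ↔
        (c' x * (g y : ℝ) < c' y * (g x : ℝ) ∨ (c' y * (g x : ℝ) = c' x * (g y : ℝ) ∧ y < x)) := fun x y => by
      simp only [hvp, sign_eq_neg_one_iff, sign_eq_zero_iff, sub_neg, sub_eq_zero]
    have hordB := KernelBootstrapAux.order_of_iff_flip _ _ hordD hbelow
    have hLc : (L σ).card ≤ 4 * c * c := by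
      have h1 := KernelBootstrapAux.card_classRank_lt_le
        (fun x y => σ (finProdFinEquiv (x, y)) = -1 ∨ (σ (finProdFinEquiv (y, x)) = 0 ∧ y < x)) hordB
        c (2 * c) g hg (fun j => R σ j < K0 (R σ))
      have h2 := KernelBootstrapAux.card_classRank_lt_le
        (fun x y => σ (finProdFinEquiv (x, y)) = 1 ∨ (σ (finProdFinEquiv (x, y)) = 0 ∧ x < y)) hordA
        c (2 * c) g hg (fun j => K0 (R σ) ≤ R σ j)
      rw [hL, Finset.filter_or]
      calc _ ≤ _ := Finset.card_union_le _ _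
        _ ≤ c * (2 * c) + c * (2 * c) := Nat.add_le_add h1 h2
        _ = 4 * c * c := by ring
    rw [hT]
    refine (Set.ncard_image_le (hEfin σ)).trans ?_
    rw [hE]
    exact hB _ _ _ _ hLc fun i => hg _
  -- (B) every vertex is a translate of a kernel vertex, for a realised sign vector
  have hsub : Set.extremePoints ℝ (convexHull ℝ ((fun e : Fin 2 →₀ ℕ => fun i : Fin 2 => ((e i : ℕ) : ℝ)) ''
      (((Finset.univ.filter fun J : Finset (Fin N) => ∑ j ∈ J, g j = v).image
        fun J => ∑ j ∈ J, d j : Finset (Fin 2 →₀ ℕ)) : Set (Fin 2 →₀ ℕ)))) ⊆ ⋃ σ ∈ hVfin.toFinset, T σ := by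
    intro e he
    obtain ⟨w, e₀, he₀X, rfl, hexp, -⟩ :=
      NewtonUnitEquationsDissociatedUniform.stub_exposedGenericDirection _ ∅ e he
    obtain ⟨c', hc⟩ : ∃ c' : Fin N → ℝ, ∀ j, c' j = ∑ i, w i * ((d j i : ℕ) : ℝ) := ⟨_, fun _ => rfl⟩
    obtain ⟨σ, hσw⟩ : ∃ σ : Fin (N * N) → SignType, σ = fun m => SignType.sign (∑ i, w i * u m i) := ⟨_, rfl⟩
    have hvp : ∀ j' j, σ (finProdFinEquiv (j', j)) = SignType.sign (c' j' * (g j : ℝ) - c' j * (g j' : ℝ)) :=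
      fun j' j => by rw [hσw]; exact hsign w c' hc j' j
    -- the exposed vertex is a subset sum of weight `v` and maximal value; competitors with another point are lower
    obtain ⟨J₀, hJ₀, rfl⟩ := Finset.mem_image.1 he₀X
    have hJ₀v : ∑ j ∈ J₀, g j = v := (Finset.mem_filter.1 hJ₀).2
    have hlt : ∀ J' : Finset (Fin N), ∑ j ∈ J', g j = v → ∑ j ∈ J', d j ≠ ∑ j ∈ J₀, d j →
        ∑ j ∈ J', c' j < ∑ j ∈ J₀, c' j := by
      intro J' hJ' hne
      have h := hexp _ (Finset.mem_image.2 ⟨J', Finset.mem_filter.2 ⟨Finset.mem_univ _, hJ'⟩, rfl⟩) hne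
      rwa [hlin w c' hc, hlin w c' hc] at h
    have hmax : ∀ J' : Finset (Fin N), ∑ j ∈ J', g j = v → ∑ j ∈ J', c' j ≤ ∑ j ∈ J₀, c' j := by
      intro J' hJ'
      by_cases heq : ∑ j ∈ J', d j = ∑ j ∈ J₀, d j
      · exact le_of_eq (by rw [← hlin w c' hc, ← hlin w c' hc, heq])
      · exact (hlt J' hJ' heq).le
    obtain ⟨α, β, hsum, hKv, hKval⟩ := hNF c' J₀ hJ₀v hmax
    rw [← hK0 (rk c')] at hKv hKval
    have hRr : rk c' = R σ := funext fun j => by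
      rw [hrk, hR]
      simp only [hvp, sign_eq_one_iff, sign_eq_zero_iff, sub_pos, sub_eq_zero]
    have hKF : canon c' (K0 (rk c')) α β = F σ (K0 (R σ)) α β := by
      rw [hF, hRr]
      exact WeightedLevelSetHullAux.canon_eq_of_signs N g c' (K0 (R σ)) α β rk hrk canon hcanon σ hvp (R σ)
        (hR σ)
    rw [hKF] at hKv hKval
    have hαβ : ∀ j, α (g j) ≤ 2 * c ∧ β (g j) ≤ 2 * c := fun j => by
      have h := (Finset.single_le_sum (fun a _ => Nat.zero_le (α a + β a))
        (Finset.mem_range.2 (Nat.lt_succ_of_le (hg j).2))).trans hsum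
      omega
    have hfact : F σ (K0 (R σ)) α β \ L σ = P σ \ L σ := by
      ext j
      simp only [hF, hL, hP, Finset.mem_sdiff, Finset.mem_filter, Finset.mem_univ, true_and]
      constructor
      · rintro ⟨h1 | h1, h2⟩
        · exact ⟨h1.1, h2⟩
        · exact absurd (Or.inr ⟨h1.1, lt_of_lt_of_le h1.2 (hαβ j).2⟩) h2
      · rintro ⟨h1, h2⟩
        refine ⟨Or.inl ⟨h1, ?_⟩, h2⟩
        by_contra h3
        exact h2 (Or.inl ⟨h1, lt_of_lt_of_le (not_le.1 h3) (hαβ j).1⟩)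
    obtain ⟨Sk, hSk⟩ : ∃ Sk : Finset (Fin N), Sk = F σ (K0 (R σ)) α β ∩ L σ := ⟨_, rfl⟩
    have hSkL : Sk ⊆ L σ := hSk ▸ Finset.inter_subset_right
    have hsplit : ∀ {M : Type} [AddCommMonoid M] (f : Fin N → M),
        ∑ j ∈ F σ (K0 (R σ)) α β, f j = ∑ j ∈ P σ \ L σ, f j + ∑ j ∈ Sk, f j := fun f => by
      rw [← hfact, hSk, ← Finset.sum_union (Finset.disjoint_sdiff_inter _ _), Finset.sdiff_union_inter]
    have hsplit_g := hsplit g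
    have hSkv : ∑ j ∈ Sk, g j = v - ∑ j ∈ P σ \ L σ, g j := by omega
    have hKpt : ∑ j ∈ F σ (K0 (R σ)) α β, d j = ∑ j ∈ J₀, d j := by
      by_contra hne
      exact absurd hKval (hlt _ hKv hne).ne
    refine Set.mem_iUnion₂.2 ⟨σ, (Set.Finite.mem_toFinset hVfin).2 (by rw [hV]; exact ⟨w, hσw⟩), ?_⟩
    rw [hT]
    refine ⟨fun i => (((∑ j ∈ Sk, d j) i : ℕ) : ℝ), ?_, ?_⟩
    · -- `pt Sk` is a strictly exposed point of the (reindexed) kernel level set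
      rw [hE, KernelBootstrapAux.image_powerset_eq_image_reindex]
      refine RefineDissociateAux.emb_mem_extremePoints_of_strict _ ?_ w ?_
      · exact Finset.mem_image.2 ⟨Sk, Finset.mem_filter.2 ⟨Finset.mem_powerset.2 hSkL, hSkv⟩, rfl⟩
      · intro s hs hne
        obtain ⟨S', hS', rfl⟩ := Finset.mem_image.1 hs
        obtain ⟨hS'L, hS'v⟩ := Finset.mem_filter.1 hS'
        rw [Finset.mem_powerset] at hS'L
        have hdisj : Disjoint (P σ \ L σ) S' :=
          Finset.disjoint_left.2 fun x hx hx' => (Finset.mem_sdiff.1 hx).2 (hS'L hx')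
        have hw' : ∑ j ∈ (P σ \ L σ) ∪ S', g j = v := by
          rw [Finset.sum_union hdisj, hS'v]
          omega
        have hne' : ∑ j ∈ (P σ \ L σ) ∪ S', d j ≠ ∑ j ∈ J₀, d j := by
          rw [Finset.sum_union hdisj, ← hKpt, hsplit d]
          exact fun h => hne (by rw [add_left_cancel h])
        have h := hlt _ hw' hne'
        rw [Finset.sum_union hdisj, ← hKval, hsplit c', add_lt_add_iff_left] at h
        rwa [hlin w c' hc, hlin w c' hc]
    · -- `e = pt (P σ \ L σ) + pt Sk`
      funext i
      simp only [Pi.add_apply, ← hKpt, hsplit d, Finsupp.coe_add, Nat.cast_add]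
  calc _ ≤ (⋃ σ ∈ hVfin.toFinset, T σ).ncard :=
        Set.ncard_le_ncard hsub ((Finset.finite_toSet _).biUnion fun σ _ => by
          rw [hT]; exact (hEfin σ).image _)
    _ ≤ hVfin.toFinset.card * B := KernelBootstrapAux.ncard_biUnion_le _ T B hTB
    _ ≤ (4 * (N * N) + 5) * B := Nat.mul_le_mul_right _ hVcard

end Summit.ValiantsHypothesis.ValiantsHypothesis.Theorems.NewtonUnitEquationsNewtonTauWeak

end
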